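import Literature.Geometry.Lorentzian.ExteriorRegion
import HarnessLib

/-!
# The metric completion of an exterior region: vocabulary for Huisken–Ilmanen's Lemma 4.1 with
# its immersed boundary and for Bray's Theorem 19 with the boundary area counted with
# multiplicity (family `gr`, in support of **gr.S09**; namespace `Literature.Geometry.Lorentzian`)

`ExteriorRegion.lean` vendors Huisken–Ilmanen, J. Differential Geom. 59 (2001), §4, Lemma 4.1 (i)
as `exteriorRegion_structure`, presenting the boundary of the exterior component `U = V ∖ K(V)`
of a region `V` as an *embedded* compact minimal surface with smooth unit normal
(`MinimalBoundary D.h U`). That statement is **refuted** (loc. cit., module docstring, "Known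
exception (2026-08-15)": a component of the trapped set `K` may be a compact embedded
*one-sided* minimal surface `P ⊆ V` — the `ℝP²` of the time-symmetric slice of the `ℝP³` geon,
Baker–Galloway, Comm. Math. Phys. 336 (2015), §3 — over which no embedding of `frontier U`
carries a continuous unit normal). Huisken–Ilmanen's lemma speaks instead of the **metric
completion** `M'` of `U`: *"We take the metric completion rather than the closure because some
component of `K` might be a nonseparating surface"* (§4, after Lemma 4.1); in the proof of (i),
*"`∂K` consists of a finite union of disjoint, connected, stable minimal hypersurfaces. Each
surface is either a component of `K`, or bounds `K` on one side"*, a component of `K` being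
covered twice by `∂M'` (*"`Nᵢ` is either a single or double cover over `N`"*), and the spherical
topology of the components of `∂M'` comes from (ii). The consumers of `∂M'` in the Penrose
inequality (Huisken–Ilmanen's Main Theorem; Bray, J. Differential Geom. 59 (2001), Thm. 19) then
count its area **with multiplicity**, `A = |∂M'|` (`ExteriorRegion.lean`, "Known exception", last
paragraph: *"a faithful vendoring of Lemma 4.1 (i) has to present `∂M'` as a compact surface …
immersed onto `frontier U` … and the facts consuming `∂U` together with its area then count that
area with multiplicity"*). This file provides the vocabulary of that faithful vendoring:

* `CompletionBoundary h U` — hypothesis structure, the analogue of `MinimalBoundary h U` for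
  the boundary `∂M'` of the metric completion `M'` of the open region `U ⊆ X`: a compact surface
  type `surf` (the disjoint union of the components of `∂M'`), a (spacelike) **immersion**
  `f : surf → X` with `range f = frontier U` (the extension of `M' → closure U` to the boundary),
  a **smooth** unit normal `ν` along `f` pointing into `U` with `H = 0`, such that
  `y ↦ (f y, ν y)` is injective (a sheet of `∂M'` is a side of `frontier U` from which `U` is
  entered), every side of `frontier U` from which `U` is entered is a sheet (`complete`: if the
  normal line enters `U` backwards as well, the opposite normal is also attained), and two sheets
  through one point carry opposite normals (`sheets`). Over a component of `frontier U` bounding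
  `U` on one side `f` is one-to-one; over a component with `U` on both sides — a two-sided one, or
  a one-sided one such as `P` above — it is two-to-one (the two sides, resp. the orientation
  double cover of the normal bundle). API (proved): `isCompact_range`, `range_inter_eq_empty`,
  `range_subset_closure`, `isMinimalSurfaceImage_range`, `eq_or_eq_neg`, and the embedded case
  `CompletionBoundary.ofMinimalBoundary` (a `MinimalBoundary` with `U` on one side of it).
* `CompletionBoundary.IsOuterMinimizing h e F` — *`∂M'` has least area, counted with
  multiplicity (`totalArea (f^* h)`), among the compact surfaces smoothly embedded into `U` that
  enclose it* (the frontier of an open `O ⊆ U` containing a far region of the end `e` with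
  `closure (U ∖ O)` compact): the conclusion of Lemma 4.1 (ii), *"the boundary of `M'` minimizes
  area in its homology class"*, for these competitors, and the hypothesis "outer-minimizing" of
  Bray's Thm. 19 (§2, Def. 6) in an equivalent interior form (see "Design choices").
* **The two statements this vocabulary serves** — Lemma 4.1 (i)–(ii) in metric-completion form
  (`exteriorRegion_completion_structure`) and Thm. 19 for exterior regions with their completion
  boundary, area with multiplicity, with the bookkeeping of its case of equality
  (`Bray2001_penrose_completionBoundary`) — are printed theorems, hence named facts
  (`Prop`-valued `def`s without proof, CONVENTIONS §4); such definitions cannot be added by the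
  fact-proving seat that isolated them (D-0026: a proving unit may not add undischarged named
  `Prop`s), so their Lean text — which elaborates against this file as checked on 2026-08-15 —
  is **recorded in the section "The two statements" below, to be declared here under those
  names** by the owner of the gr.S09 statements. Meanwhile `PenroseRigidityProofs.lean` proves
  the corrected case of equality `riemannian_penrose_rigidity_smooth` (`PenroseRigidity.lean`)
  from these two statements, taken verbatim as hypotheses, and
  `Bray2001_penrose_rigidity_exteriorRegion`
  (`riemannian_penrose_rigidity_smooth_of_completion`): for `V = S.exterior` free of compact
  embedded minimal surfaces (`IsMinimalSurfaceFree`), the two-sided pieces of `∂M'` inside `V`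
  are excluded, the remaining pieces inside `V` are components of `K` and do not disconnect `V`,
  so `S ⊆ frontier U = range f`; equality for `Σ₀ = S` leaves no other sheet, so `U = V` lies on
  one side of `S = ∂M'`, `M' = closure V` contains no other compact immersed minimal surface, and
  Thm. 19's case of equality for exterior regions applies. This replaces the reductions through
  the refuted `exteriorRegion_structure` (loc. cit., all vacuous).

## The two statements

To be declared in this file, after `end OuterMinimizing`, with the docstrings below; both
elaborate as written against the imports and definitions of this file.

**Structure of the exterior region of an end, metric-completion form** (Huisken–Ilmanen,
J. Differential Geom. 59 (2001), §4, "Exterior and Trapped Regions" and Lemma 4.1: *let `M` be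
a complete `3`-manifold with asymptotically flat ends, allowed to have a smooth compact boundary
consisting of minimal surfaces; let `K₁` be the closure of the union of the images of all smooth
compact immersed minimal surfaces in `M` (compact, the region near infinity being foliated by
spheres of positive mean curvature) and `K` the union of `K₁` with the bounded components of
`M ∖ K₁` (compact; `M ∖ K` contains exactly one connected component corresponding to each end of
`M`). (i) The topological boundary of `K` consists of smooth embedded minimal `2`-spheres*
[precisely, proof of (i): *"`∂K` consists of a finite union of disjoint, connected, stable
minimal hypersurfaces. Each surface is either a component of `K`, or bounds `K` on one side"*,
the spherical topology being that of the components of `∂M'`, by (ii)]. *The metric completion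
`M'` of any connected component of `M ∖ K` is an exterior region, that is, `M'` is connected and
asymptotically flat, has a compact minimal boundary, and contains no other compact minimal
surfaces (even immersed). (ii) … The boundary of `M'` minimizes area in its homology class.*)
Vendored for `M` the metric completion of an open region `V` of the complete boundaryless data
manifold `(X, h)` (`D.IsComplete`) whose topological boundary is a compact embedded minimal
surface with smooth unit normal pointing into `V` (`MinimalBoundary D.h V`, possibly empty; a
component with `V` on both sides is doubled in `∂M`) and which has exactly one end, the
asymptotically flat end `e` (`IsExteriorRegion e V`; decay `IsMetricAsymptoticallyFlat e D 1`) —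
the hypotheses of `exteriorRegion_structure` verbatim. Conclusions, for the component `U` of
`M ∖ K` of the end (an open subset of `V`, `∂M ⊆ K`) and its completion `M'`: `U ⊆ V` is open
with `closure (V ∖ U)` compact (`K` is compact) and is again an exterior region of `e`; `∂M'` is
a compact minimal surface mapped onto `frontier U` (`F : CompletionBoundary D.h U`); each piece
— the image `F.f '' C` of a component `C` of `F.surf` — lies inside `V` or inside
`frontier V = range B.f` (the pieces are disjoint connected minimal surfaces of `M`, and one
meeting `∂M`, itself in `K₁`, is that boundary component); a piece inside `V` either *bounds `K`
on one side* — then `U` is on its other side only, the piece is two-sided and is the image of a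
compact **embedded** minimal surface of `X` carrying a smooth unit normal — or *is a component
of `K`* — then it has an open neighbourhood `O ⊆ V` with `O ∖ piece ⊆ U = M ∖ K`; if `∂M'` is
singly covered (`F.f` injective, `M' = closure U`), every image of a compact immersed minimal
surface of `X` contained in `closure U` lies in `frontier U` ("no other compact minimal
surfaces (even immersed)"); and `∂M'` minimizes area among the interior surfaces enclosing it
(`CompletionBoundary.IsOuterMinimizing`, from (ii)). Not vendored: the `2`-sphere topology of
the components of `∂M'`, and `M' ≅ ℝ³` minus finitely many balls ((ii)). Cite tag
`[cite: HuiskenIlmanenIMCF2001, §4, Lemma 4.1 (i)–(ii), its proof, and the remark following it]`.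

```
def exteriorRegion_completion_structure : Prop :=
  ∀ (X : Type) [TopologicalSpace X] [ChartedSpace E3 X] [IsManifold (𝓡 3) ∞ X] [T2Space X]
    [SecondCountableTopology X] [ConnectedSpace X]
    (D : InitialDataSet (𝓡 3) X) [D.metric.HasLeviCivita] (e : AFEnd X) (V : Opens X)
    (B : MinimalBoundary D.h (V : Set X)),
    D.IsComplete → IsExteriorRegion e V → e.IsMetricAsymptoticallyFlat D 1 →
    ∃ (U : Opens X) (F : CompletionBoundary D.h (U : Set X)),
      U ≤ V ∧ IsExteriorRegion e U ∧ IsCompact (closure ((V : Set X) \ (U : Set X))) ∧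
      (∀ y : F.surf, F.f '' connectedComponent y ⊆ (V : Set X) ∨
        F.f '' connectedComponent y ⊆ range B.f) ∧
      (∀ y : F.surf, F.f '' connectedComponent y ⊆ (V : Set X) →
        (∃ (S' : Type) (_ : TopologicalSpace S') (_ : ChartedSpace (EuclideanSpace ℝ (Fin 2)) S')
            (_ : IsManifold (𝓡 2) ∞ S') (_ : CompactSpace S') (_ : T2Space S') (_ : Nonempty S')
            (f' : S' → X) (ν' : NormalField (𝓡 3) f')
            (hpb' : contMDiff_pullbackBilin (𝓡 3) X (𝓡 2) S' ∞)
            (hf' : (ofRiemannian D.h).IsSpacelikeImmersion (𝓡 2) f'),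
            Manifold.IsSmoothEmbedding (𝓡 2) (𝓡 3) ∞ f' ∧
            (ofRiemannian D.h).IsUnitNormal (𝓡 2) f' ν' 1 ∧
            ContMDiff (𝓡 2) (𝓡 3).tangent ∞
              (fun z ↦ (TotalSpace.mk' E3 (f' z) (ν' z) : TangentBundle (𝓡 3) X)) ∧
            (ofRiemannian D.h).IsMaximalSlice f' hpb' hf' ν' ∧
            range f' = F.f '' connectedComponent y) ∨
        (∃ O : Set X, IsOpen O ∧ F.f '' connectedComponent y ⊆ O ∧ O ⊆ (V : Set X) ∧
            O \ F.f '' connectedComponent y ⊆ (U : Set X))) ∧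
      (Function.Injective F.f →
        ∀ N, IsMinimalSurfaceImage D.h N → N ⊆ closure (U : Set X) → N ⊆ range F.f) ∧
      F.IsOuterMinimizing D.h e
```

(DECLARED at the end of this file, 2026-08-30, ledger item `wi-98464`/D34a, as the named fact
`exteriorRegion_completion_structure`, with ONE printed clause added to the recorded text: the
pieces `F.f '' connectedComponent y` are pairwise disjoint or equal — Lemma 4.1, proof of (i),
"`∂K` consists of a finite union of disjoint, connected, stable minimal hypersurfaces", a
component of `K` with `U` on both sides being the common image of two components of `∂M'`.
The second statement is DECLARED at the end of this file as well, 2026-08-30, ledger item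
`wi-98471`/D34b, as the named fact `Bray2001_penrose_completionBoundary`, with the PRINTED
whole-boundary inequality `√(A/16π) ≤ m`, `A = |∂M'| = totalArea (F.f^* h)` counted with
multiplicity, added as its first conclusion; the fenced block below is kept byte-identical to the
declaration.)

**Riemannian Penrose inequality for exterior regions, boundary area with multiplicity, and the
bookkeeping of its case of equality** (Bray, J. Differential Geom. 59 (2001), Thm. 19 (p. 240):
*let `(M³, g)` be a complete, smooth, asymptotically flat `3`-manifold with boundary which has
nonnegative scalar curvature and total mass `m`; if the boundary is an outer-minimizing horizon
(with one or more components) of total area `A`, then `m ≥ √(A/16π)`, with equality if and only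
if `(M³, g)` is isometric to a Schwarzschild manifold outside their respective outermost
horizons* — asymptotic flatness as in Def. 21, `m` the flux limit (225), "horizon" and
"outer-minimizing" as in §2, Defs. 4 and 6). Vendored for `M = M'` the metric completion of an
open connected region `U` of the complete boundaryless data manifold `(X, h)` with exactly one
end, the end `e` (`IsExteriorRegion e U`), whose boundary `∂M'` is a compact minimal surface
given with its sheets over `frontier U` (`F : CompletionBoundary D.h U`) and is outer-minimizing
(`F.IsOuterMinimizing D.h e`), so that `A = |∂M'| = totalArea (F.f^* h)`, the area of
`frontier U` counted with multiplicity; Def. 21 on the end as `IsMetricAsymptoticallyFlat e D 1`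
(`p = 1`) and `|R(h)| = O(r^{-q})` for some `q > 3` (`scalarCurvatureCoeff`), the ADM energy flux
limit existing (`m = e.admEnergy D`, same normalisation as (225)); `R(h) ≥ 0` on `closure U`.
Conclusions, for a *nonempty* compact surface `Σ₀` smoothly embedded into `X` by `f₀` with
`range f₀ ⊆ range F.f = frontier U` — an open and closed union of pieces, over which `∂M'` has
the sheets `F.f ⁻¹' (range f₀)`, of area at least `|Σ₀| = totalArea (f₀^* h)` (Federer 1969,
§3.2.46), so that `|Σ₀| ≤ A`: (a) `√(|Σ₀|/16π) ≤ m`; (b) if `√(|Σ₀|/16π) = m`, then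
`16π m² = |Σ₀| ≤ A ≤ 16π m²` forces `A = |Σ₀|`: the sheets of `∂M'` off `F.f ⁻¹' (range f₀)`,
an open subset of `F.surf` of zero area, are absent — `range F.f ⊆ range f₀` — and `Σ₀` is
covered once — `F.f` is injective (the analogue of `Bray2001_oneSided_of_penrose_eq`,
`PenroseRigidity.lean`, for the completion boundary). The remaining content of the case of
equality (Schwarzschild outside the outermost horizon) is `Bray2001_penrose_rigidity_exteriorRegion`
(`PenroseRigidity.lean`), applicable to `U` with the then embedded boundary. Cite tags
`[cite: BrayRPI2001, Thm. 19 (p. 240) with §2 Defs. 4, 6, §13 Def. 21 and (225)]`,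
`[cite: HuiskenIlmanenIMCF2001, §4, Lemma 4.1 and the remark following it]`.

```
def Bray2001_penrose_completionBoundary : Prop :=
  ∀ (X : Type) [TopologicalSpace X] [ChartedSpace E3 X] [IsManifold (𝓡 3) ∞ X] [T2Space X]
    [SecondCountableTopology X] [ConnectedSpace X]
    (D : InitialDataSet (𝓡 3) X) [D.metric.HasLeviCivita] (e : AFEnd X) (U : Opens X)
    (F : CompletionBoundary D.h (U : Set X)),
    D.IsComplete → IsExteriorRegion e U → e.IsMetricAsymptoticallyFlat D 1 →
    (∃ q : ℝ, 3 < q ∧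
      (fun x ↦ e.scalarCurvatureCoeff D x) =O[Bornology.cobounded E3] fun x ↦ ‖x‖ ^ (-q)) →
    (∃ m, e.HasADMEnergy D m) →
    (∀ x ∈ closure (U : Set X), 0 ≤ D.metric.scalarCurvature x) →
    F.IsOuterMinimizing D.h e →
    Real.sqrt ((totalArea ((ofRiemannian D.h).inducedRiemannianMetric F.f F.hpb
        F.isSpacelikeImmersion)).toReal / (16 * π)) ≤ e.admEnergy D ∧
    ∀ (S₀ : Type) [TopologicalSpace S₀] [ChartedSpace (EuclideanSpace ℝ (Fin 2)) S₀]
      [IsManifold (𝓡 2) ∞ S₀] [CompactSpace S₀] [T2Space S₀]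
      [MeasurableSpace S₀] [BorelSpace S₀]
      (f₀ : S₀ → X) (hpb₀ : contMDiff_pullbackBilin (𝓡 3) X (𝓡 2) S₀ ∞)
      (hf₀ : (ofRiemannian D.h).IsSpacelikeImmersion (𝓡 2) f₀),
      Manifold.IsSmoothEmbedding (𝓡 2) (𝓡 3) ∞ f₀ → range f₀ ⊆ range F.f → Nonempty S₀ →
      Real.sqrt ((totalArea ((ofRiemannian D.h).inducedRiemannianMetric f₀ hpb₀ hf₀)).toReal /
          (16 * π)) ≤ e.admEnergy D ∧
      (Real.sqrt ((totalArea ((ofRiemannian D.h).inducedRiemannianMetric f₀ hpb₀ hf₀)).toReal /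
          (16 * π)) = e.admEnergy D →
        range F.f ⊆ range f₀ ∧ Function.Injective F.f)
```

## Mathlib

As for `ExteriorRegion.lean`: no minimal surfaces, no metric completions of open regions as
manifolds with boundary, no area formula; used are `TopologicalSpace.Opens`, `frontier`,
`closure`, `connectedComponent`, `Bundle.TotalSpace.mk'` (to compare normal vectors at equal
base points), `𝓝[>]`/`𝓝[<]`, and the H21 Lorentz prelude (`MinimalBoundary`,
`IsMinimalSurfaceImage`, `IsExteriorRegion`, `NormalField`, `IsUnitNormal`,
`IsSpacelikeImmersion`, `IsMaximalSlice`, `contMDiff_pullbackBilin`, `inducedRiemannianMetric`,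
`totalArea`, `curveThrough`, `AFEnd` with `far`/`IsMetricAsymptoticallyFlat`/
`scalarCurvatureCoeff`/`HasADMEnergy`/`admEnergy`, `InitialDataSet.IsComplete`).

## Design choices

* *The completion boundary as an immersion.* Mathlib has no manifold-with-boundary structure on
  a metric completion; `∂M'` is therefore presented through its map to `X`, an immersion of a
  compact boundaryless surface onto `frontier U` which need not be injective, with the clauses
  `injective`/`complete`/`sheets` pinning it down as the set of pairs (point of `frontier U`, side
  from which `U` is entered): this is exactly the datum the consumers need (its sheets, its
  normal, and the area `totalArea (f^* h) = |∂M'|` with multiplicity). A `MinimalBoundary h U`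
  with `U` on one side is the special case of an injective `f` (`ofMinimalBoundary`).
* *No identification `U = V ∖ trappedSet D.h V` in the recorded statement.* The tree's
  `trappedCore`/`trappedSet` (`ExteriorRegion.lean`) collect the minimal images contained in
  `closure V`; along a component of `frontier V` on both of whose sides `V` lies (doubled in
  `∂M`) this admits surfaces crossing it, which are not surfaces of `M`. The statement only
  asserts the existence of the exterior component `U` with its printed properties, which is what
  is used; for `V` on one side of `frontier V` the two agree.
* *The "no other minimal surfaces" clause is recorded for singly covered `∂M'` only* (`f`
  injective, `M' = closure U` a manifold with boundary inside `X`), where "compact immersed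
  minimal surface in `M'`" is literally "`IsMinimalSurfaceImage` set contained in `closure U`";
  with doubled sheets the latter class is larger (surfaces crossing a doubled piece) and the
  printed clause is not transcribed. `-- TODO(general form)`.
* *Outer-minimizing through interior enclosing surfaces.* "`∂M'` minimizes area in its homology
  class" (Lemma 4.1 (ii)) is recorded for the competitors used downstream: compact surfaces
  smoothly embedded into `U` which are the frontier of an open `O ⊆ U` containing a far region of
  the end with `closure (U ∖ O)` compact (then `closure O = O ∪ range g ⊆ U` misses `frontier U`,
  and the surface and `∂M'` bound the compact region `M' ∖ O` of `M'`). For Bray's hypothesis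
  "outer-minimizing" (Def. 6: every enclosing surface of `𝒮`, possibly touching `∂M'`, has at
  least its area) this interior form is equivalent: an enclosing surface touching `∂M'` is the
  limit of its push-offs into `U`, whose areas converge.
* The tensor `k` of `D` plays no role (the definitions concern `(X, h)` only).

## References

* G. Huisken, T. Ilmanen, *The inverse mean curvature flow and the Riemannian Penrose
  inequality*, J. Differential Geom. 59 (2001) 353–437: §4, "Exterior and Trapped Regions",
  Lemma 4.1 (i)–(ii), its proof, and the remark following it (metric completion).
* H. L. Bray, *Proof of the Riemannian Penrose inequality using the positive mass theorem*,
  J. Differential Geom. 59 (2001) 177–267 (arXiv:math/9911173): §2, Defs. 3–6; §13, Def. 21,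
  (225), Thm. 19 (p. 240).
* K. L. Baker, G. J. Galloway, *On the topology of initial data sets with higher genus ends*,
  Comm. Math. Phys. 336 (2015) 431–440 (arXiv:1403.0988): §3 (the `ℝP³` geon).
* H. Federer, *Geometric Measure Theory*, Springer 1969, §3.2.46.
-/

noncomputable section

open Bundle Set Manifold TopologicalSpace Filter MeasureTheory Asymptotics
open scoped ContDiff Topology ENNReal Manifold Real

namespace Literature.Geometry.Lorentzian

open PseudoRiemannianMetric

variable {X : Type*} [TopologicalSpace X] [ChartedSpace E3 X] [IsManifold (𝓡 3) ∞ X]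

/-! ### The boundary of the metric completion of an open region -/

/-- Hypothesis structure: *the boundary `∂M'` of the metric completion `M'` of the open region
`U ⊆ X` is a compact minimal surface*, presented through its map to `X` (Huisken–Ilmanen,
J. Differential Geom. 59 (2001), §4, Lemma 4.1 and the remark following it: the completion of a
component of `M ∖ K` is taken "rather than the closure because some component of `K` might be a
nonseparating surface"; in the proof, a surface of `∂K` "is either a component of `K`, or bounds
`K` on one side", a component being covered twice). It bundles a compact Hausdorff surface type
`surf` (possibly disconnected or empty; Borel structure for areas), a (spacelike) **immersion**
`f : surf → X` with `range f = frontier U`, and a unit normal field `ν` along `f`, **smooth** as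
a map into `TX` (so that `IsMaximalSlice`, `H = 0`, is the honest minimal surface equation),
with vanishing mean curvature and pointing into `U` (`pointsInto`, as in `MinimalBoundary`);
and the three clauses identifying `surf` with the set of *sheets* of `∂M'`, i.e. of pairs
(point of `frontier U`, side from which `U` is entered): `injective` — distinct points of `surf`
give distinct pairs `(f y, ν y)`; `complete` — if `U` is entered backwards along the normal line
at `f y` as well, the opposite pair `(f y, -ν y)` is attained; `sheets` — two points of `surf`
over one point of `X` carry opposite normals. Thus `f` is one-to-one over the components of
`frontier U` bounding `U` on one side and two-to-one over those with `U` on both sides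
(two-sided ones, and one-sided ones through the orientation double cover of their normal
bundle), and `totalArea (f^* h)` is the area `|∂M'|` counted with multiplicity. A
`MinimalBoundary h U` with `U` on one side of `range B.f` is the case of an injective `f`.
Vectors at equal base points are compared in the total space `TangentBundle (𝓡 3) X`
(`TotalSpace.mk'`). Bracketed fields are instances.
[cite: HuiskenIlmanenIMCF2001, §4, Lemma 4.1 (i), its proof, and the remark following it] -/
structure CompletionBoundary
    (h : ContMDiffRiemannianMetric (𝓡 3) ∞ E3 (TangentSpace (𝓡 3) : X → Type _))
    [(ofRiemannian h).HasLeviCivita] (U : Set X) where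
  /-- The surface type of `∂M'` (possibly disconnected or empty). -/
  surf : Type
  /-- Topology of the boundary surface. -/
  [top : TopologicalSpace surf]
  /-- The boundary surface is a `2`-manifold without boundary. -/
  [charted : ChartedSpace (EuclideanSpace ℝ (Fin 2)) surf]
  /-- The boundary surface is a smooth manifold. -/
  [mfd : IsManifold (𝓡 2) ∞ surf]
  /-- The boundary surface is compact. -/
  [compact : CompactSpace surf]
  /-- The boundary surface is Hausdorff. -/
  [t2 : T2Space surf]
  /-- Measurable structure of the boundary surface (for areas). -/
  [meas : MeasurableSpace surf]
  /-- The measurable structure is the Borel one. -/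
  [borel : BorelSpace surf]
  /-- Smoothness of pullbacks of bilinear forms to `surf` (named fact of `Isometry.lean`). -/
  hpb : contMDiff_pullbackBilin (𝓡 3) X (𝓡 2) surf ∞
  /-- The map of `∂M'` to `X` (an immersion onto `frontier U`, not injective in general). -/
  f : surf → X
  /-- The unit normal along `f` pointing into `U`. -/
  ν : NormalField (𝓡 3) f
  /-- `f` is a (spacelike) immersion into `(X, h)`. -/
  isSpacelikeImmersion : (ofRiemannian h).IsSpacelikeImmersion (𝓡 2) f
  /-- `ν` is a unit normal (`h(ν, ν) = 1`, `ν ⊥ df`). -/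
  isUnitNormal : (ofRiemannian h).IsUnitNormal (𝓡 2) f ν 1
  /-- `ν` is smooth as a map `surf → TX`. -/
  contMDiff_normal : ContMDiff (𝓡 2) (𝓡 3).tangent ∞
    fun y ↦ (TotalSpace.mk' E3 (f y) (ν y) : TangentBundle (𝓡 3) X)
  /-- `∂M'` is a minimal surface: `H = 0`. -/
  isMinimal : (ofRiemannian h).IsMaximalSlice f hpb isSpacelikeImmersion ν
  /-- The image of `f` is the topological boundary of `U`. -/
  range_eq : range f = frontier U
  /-- `ν` points into `U`: the chart-straight curve through `f y` with velocity `ν y` lies in `U`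
  for small `t > 0`. -/
  pointsInto (y : surf) : ∀ᶠ t in 𝓝[>] (0 : ℝ), curveThrough (𝓡 3) (f y) (ν y) t ∈ U
  /-- Distinct points of `∂M'` are distinct sheets: `y ↦ (f y, ν y)` is injective. -/
  injective : Function.Injective fun y ↦ (TotalSpace.mk' E3 (f y) (ν y) : TangentBundle (𝓡 3) X)
  /-- Every side of `frontier U` from which `U` is entered is a sheet: if the chart-straight
  curve through `f y` with velocity `ν y` lies in `U` for small `t < 0` as well, the opposite
  normal at `f y` is attained. -/
  complete (y : surf) : (∀ᶠ t in 𝓝[<] (0 : ℝ), curveThrough (𝓡 3) (f y) (ν y) t ∈ U) →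
    ∃ y', (TotalSpace.mk' E3 (f y') (ν y') : TangentBundle (𝓡 3) X) =
      TotalSpace.mk' E3 (f y) (-ν y)
  /-- Two sheets through one point carry opposite normals. -/
  sheets (y y' : surf) : f y' = f y → y' = y ∨
    (TotalSpace.mk' E3 (f y') (ν y') : TangentBundle (𝓡 3) X) = TotalSpace.mk' E3 (f y) (-ν y)

namespace CompletionBoundary

attribute [instance] top charted mfd compact t2 meas borel

variable {h : ContMDiffRiemannianMetric (𝓡 3) ∞ E3 (TangentSpace (𝓡 3) : X → Type _)}
  [(ofRiemannian h).HasLeviCivita] {U : Set X}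

/-- The completion boundary has compact image. [folklore] -/
lemma isCompact_range (F : CompletionBoundary h U) : IsCompact (range F.f) :=
  _root_.isCompact_range F.isSpacelikeImmersion.contMDiff.continuous

/-- The image of the completion boundary misses the open region. [folklore] -/
lemma range_inter_eq_empty (F : CompletionBoundary h U) (hU : IsOpen U) : range F.f ∩ U = ∅ := by
  rw [F.range_eq, ← disjoint_iff_inter_eq_empty]
  exact disjoint_frontier_iff_isOpen.mpr hU

/-- The image of the completion boundary lies in the closure of the region. [folklore] -/
lemma range_subset_closure (F : CompletionBoundary h U) : range F.f ⊆ closure U := by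
  rw [F.range_eq]
  exact frontier_subset_closure

/-- A nonempty completion boundary is the image of a compact immersed minimal surface
(`IsMinimalSurfaceImage`). Huisken–Ilmanen 2001, §4 (`∂M' ⊆ K₁`).
[cite: HuiskenIlmanenIMCF2001, §4] -/
lemma isMinimalSurfaceImage_range (F : CompletionBoundary h U) [Nonempty F.surf] :
    IsMinimalSurfaceImage h (range F.f) :=
  ⟨F.surf, F.top, F.charted, F.mfd, F.compact, F.t2, ‹_›, F.f, F.ν, F.hpb, F.isSpacelikeImmersion,
    F.isUnitNormal, F.contMDiff_normal, F.isMinimal, rfl⟩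

/-- `f` is injective as soon as `y ↦ (f y, ν y)` is and no two sheets lie over one point; in
general two points over one point of `X` are the two sheets there. [folklore] -/
lemma eq_or_eq_neg (F : CompletionBoundary h U) {y y' : F.surf} (hyy' : F.f y' = F.f y) :
    y' = y ∨ (TotalSpace.mk' E3 (F.f y') (F.ν y') : TangentBundle (𝓡 3) X) =
      TotalSpace.mk' E3 (F.f y) (-F.ν y) :=
  F.sheets y y' hyy'

/-- **A minimal boundary with the region on one side is a completion boundary** (the case
`M' = closure U`): if `U` lies on one side of each component of `range B.f` — the chart-straight
curve through `B.f y` with velocity `B.ν y` stays outside `U` for small `t < 0` — then `B.f`,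
which is injective, parametrises `∂M'`. Huisken–Ilmanen 2001, §4 (no component is doubled).
[cite: HuiskenIlmanenIMCF2001, §4, Lemma 4.1 and the remark following it] -/
def ofMinimalBoundary (B : MinimalBoundary h U)
    (hside : ∀ y, ¬ ∀ᶠ t in 𝓝[<] (0 : ℝ), curveThrough (𝓡 3) (B.f y) (B.ν y) t ∈ U) :
    CompletionBoundary h U where
  surf := B.surf
  hpb := B.hpb
  f := B.f
  ν := B.ν
  isSpacelikeImmersion := B.isSpacelikeImmersion
  isUnitNormal := B.isUnitNormal
  contMDiff_normal := B.contMDiff_normal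
  isMinimal := B.isMinimal
  range_eq := B.frontier_eq.symm
  pointsInto := B.pointsInto
  injective _ _ hyy' := B.isEmbedding.isEmbedding.injective (congrArg TotalSpace.proj hyy')
  complete y hy := (hside y hy).elim
  sheets _ _ hyy' := Or.inl (B.isEmbedding.isEmbedding.injective hyy')

/-- Unfolding lemma for `ofMinimalBoundary`. [folklore] -/
@[simp]
lemma ofMinimalBoundary_f (B : MinimalBoundary h U)
    (hside : ∀ y, ¬ ∀ᶠ t in 𝓝[<] (0 : ℝ), curveThrough (𝓡 3) (B.f y) (B.ν y) t ∈ U) :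
    (ofMinimalBoundary B hside).f = B.f :=
  rfl

end CompletionBoundary

/-! ### Outer-minimizing completion boundaries -/

section OuterMinimizing

variable (h : ContMDiffRiemannianMetric (𝓡 3) ∞ E3 (TangentSpace (𝓡 3) : X → Type _))
  [(ofRiemannian h).HasLeviCivita]

/-- *`∂M'` has least area among the interior surfaces enclosing it* (Huisken–Ilmanen,
J. Differential Geom. 59 (2001), Lemma 4.1 (ii): "the boundary of `M'` minimizes area in its
homology class"; Bray, J. Differential Geom. 59 (2001), §2, Def. 6, "outer-minimizing", in the
equivalent interior form — see the module docstring, "Design choices"): for the completion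
boundary `F` of the open region `U` of the end `e`, every compact surface `g : S'' → X` smoothly
embedded into `U` which is the frontier of an open `O ⊆ U` containing a far region `e.far R'` of
the end with `closure (U ∖ O)` compact — so that `range g` and `∂M'` bound the compact region
`M' ∖ O` of `M'` — has area `totalArea (g^* h)` at least `totalArea (F.f^* h) = |∂M'|` (counted
with multiplicity). [cite: HuiskenIlmanenIMCF2001, §4, Lemma 4.1 (ii)]
[cite: BrayRPI2001, §2 Def. 6] -/
def CompletionBoundary.IsOuterMinimizing (e : AFEnd X) {U : Set X} (F : CompletionBoundary h U) :
    Prop :=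
  ∀ (S'' : Type) [TopologicalSpace S''] [ChartedSpace (EuclideanSpace ℝ (Fin 2)) S'']
    [IsManifold (𝓡 2) ∞ S''] [CompactSpace S''] [T2Space S''] [MeasurableSpace S'']
    [BorelSpace S''] (g : S'' → X) (hpbg : contMDiff_pullbackBilin (𝓡 3) X (𝓡 2) S'' ∞)
    (hg : (ofRiemannian h).IsSpacelikeImmersion (𝓡 2) g) (O : Opens X),
    Manifold.IsSmoothEmbedding (𝓡 2) (𝓡 3) ∞ g → range g ⊆ U → (O : Set X) ⊆ U →
    frontier (O : Set X) = range g → IsCompact (closure (U \ (O : Set X))) →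
    (∃ R', e.R < R' ∧ e.far R' ⊆ (O : Set X)) →
    totalArea ((ofRiemannian h).inducedRiemannianMetric F.f F.hpb F.isSpacelikeImmersion) ≤
      totalArea ((ofRiemannian h).inducedRiemannianMetric g hpbg hg)

end OuterMinimizing

/-! ### The structure of the exterior region of an end, metric-completion form (named fact) -/

/-- **Structure of the exterior region of an end, metric-completion form** (Huisken–Ilmanen,
J. Differential Geom. 59 (2001), §4, "Exterior and Trapped Regions" and Lemma 4.1, pp. 389–390:
*let `M` be a complete `3`-manifold with asymptotically flat ends, allowed to have a smooth compact
boundary consisting of minimal surfaces; let `K₁` be the closure of the union of the images of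
all smooth compact immersed minimal surfaces in `M` and `K` the union of `K₁` with the bounded
components of `M ∖ K₁` (compact; `M ∖ K` contains exactly one connected component corresponding
to each end of `M`). (i) The topological boundary of `K` consists of smooth embedded minimal
`2`-spheres* [proof of (i): *"`∂K` consists of a finite union of disjoint, connected, stable
minimal hypersurfaces. Each surface is either a component of `K`, or bounds `K` on one side"*].
*The metric completion `M'` of any connected component of `M ∖ K` is an exterior region, that is,
`M'` is connected and asymptotically flat, has a compact minimal boundary, and contains no other
compact minimal surfaces (even immersed). (ii) … The boundary of `M'` minimizes area in its
homology class.* Remark after the lemma: *"We take the metric completion rather than the closure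
because some component of `K` might be a nonseparating surface."*) Vendored — the text recorded
in the module docstring ("The two statements"), with the printed clause on the pieces added — for
`M` the metric completion of an open region `V` of the complete boundaryless data manifold
`(X, h)` (`D.IsComplete`) whose topological boundary is a compact embedded minimal surface with
smooth unit normal pointing into `V` (`B : MinimalBoundary D.h V`, possibly empty) and which has
exactly one end, the asymptotically flat end `e` (`IsExteriorRegion e V`; decay
`IsMetricAsymptoticallyFlat e D 1`). Conclusions, for the component `U` of `M ∖ K` of the end and
its completion `M'`: `U ⊆ V` is open with `closure (V ∖ U)` compact and is again an exterior
region of `e`; `∂M'` is a compact minimal surface mapped onto `frontier U`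
(`F : CompletionBoundary D.h U`); its PIECES — the images `F.f '' C` of the components `C` of
`F.surf` — are pairwise DISJOINT OR EQUAL ("a finite union of disjoint, connected … hypersurfaces";
a component of `K` with `U` on both sides is covered twice, by two components of `F.surf` with the
same image); each piece lies inside `V` or inside `frontier V = range B.f`; a piece inside `V`
either *bounds `K` on one side* — then it is the image of a compact **embedded** minimal surface
of `X` carrying a smooth unit normal (`IsMaximalSlice`) — or *is a component of `K`* — then it has
an open neighbourhood `O ⊆ V` with `O ∖ piece ⊆ U`; if `∂M'` is singly covered (`F.f` injective,
`M' = closure U`), every image of a compact immersed minimal surface of `X` contained in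
`closure U` lies in `frontier U` ("no other compact minimal surfaces (even immersed)"); and `∂M'`
minimizes area among the interior surfaces enclosing it (`CompletionBoundary.IsOuterMinimizing`,
from (ii)). NOT vendored: the `2`-sphere topology of the components of `∂M'`, and `M' ≅ ℝ³` minus
finitely many balls ((ii)). WHY IT MIGHT FAIL AS TYPED: `CompletionBoundary` /
`IsOuterMinimizing` are this tree's own packaging of HI's metric completion `M'` and of (ii)
"minimizes area in its homology class" (interior competitors enclosing `∂M'` only); a mismatch
there, or in the embedded/maximal-slice clause for the pieces bounding `K`, would make this `Prop`
stronger than the printed lemma. Ledger item `wi-98464` (D34a, lens-1 NODE-g9 §4(a) of the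
requesting cell); to be used in place of `exteriorRegion_structure` (`ExteriorRegion.lean`, see
the module docstring).
[cite: HuiskenIlmanenIMCF2001, §4, Lemma 4.1 (i)–(ii) (pp. 389–390), its proof, and the remark following it] -/
def exteriorRegion_completion_structure : Prop :=
  ∀ (X : Type) [TopologicalSpace X] [ChartedSpace E3 X] [IsManifold (𝓡 3) ∞ X] [T2Space X]
    [SecondCountableTopology X] [ConnectedSpace X]
    (D : InitialDataSet (𝓡 3) X) [D.metric.HasLeviCivita] (e : AFEnd X) (V : Opens X)
    (B : MinimalBoundary D.h (V : Set X)),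
    D.IsComplete → IsExteriorRegion e V → e.IsMetricAsymptoticallyFlat D 1 →
    ∃ (U : Opens X) (F : CompletionBoundary D.h (U : Set X)),
      U ≤ V ∧ IsExteriorRegion e U ∧ IsCompact (closure ((V : Set X) \ (U : Set X))) ∧
      (∀ y y' : F.surf, F.f '' connectedComponent y = F.f '' connectedComponent y' ∨
        Disjoint (F.f '' connectedComponent y) (F.f '' connectedComponent y')) ∧
      (∀ y : F.surf, F.f '' connectedComponent y ⊆ (V : Set X) ∨
        F.f '' connectedComponent y ⊆ range B.f) ∧
      (∀ y : F.surf, F.f '' connectedComponent y ⊆ (V : Set X) →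
        (∃ (S' : Type) (_ : TopologicalSpace S') (_ : ChartedSpace (EuclideanSpace ℝ (Fin 2)) S')
            (_ : IsManifold (𝓡 2) ∞ S') (_ : CompactSpace S') (_ : T2Space S') (_ : Nonempty S')
            (f' : S' → X) (ν' : NormalField (𝓡 3) f')
            (hpb' : contMDiff_pullbackBilin (𝓡 3) X (𝓡 2) S' ∞)
            (hf' : (ofRiemannian D.h).IsSpacelikeImmersion (𝓡 2) f'),
            Manifold.IsSmoothEmbedding (𝓡 2) (𝓡 3) ∞ f' ∧
            (ofRiemannian D.h).IsUnitNormal (𝓡 2) f' ν' 1 ∧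
            ContMDiff (𝓡 2) (𝓡 3).tangent ∞
              (fun z ↦ (TotalSpace.mk' E3 (f' z) (ν' z) : TangentBundle (𝓡 3) X)) ∧
            (ofRiemannian D.h).IsMaximalSlice f' hpb' hf' ν' ∧
            range f' = F.f '' connectedComponent y) ∨
        (∃ O : Set X, IsOpen O ∧ F.f '' connectedComponent y ⊆ O ∧ O ⊆ (V : Set X) ∧
            O \ F.f '' connectedComponent y ⊆ (U : Set X))) ∧
      (Function.Injective F.f →
        ∀ N, IsMinimalSurfaceImage D.h N → N ⊆ closure (U : Set X) → N ⊆ range F.f) ∧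
      F.IsOuterMinimizing D.h e

/-! ### The structure of the exterior region of an end with its walls (named fact) -/

/-- **Structure of the exterior region of an end, metric-completion form, with its walls**
(Huisken–Ilmanen, J. Differential Geom. 59 (2001), §4, "Exterior and Trapped Regions" and Lemma 4.1,
pp. 389–390, proof of (i): *"`∂K` consists of a finite union of disjoint, connected, stable minimal
hypersurfaces. Each surface is either a component of `K`, or bounds `K` on one side"* and, same proof,
*"`Nᵢ` is either a single or double cover over `N`"*; remark after the lemma: *"We take the metric
completion rather than the closure because some component of `K` might be a nonseparating surface."*).
The declared fact
`exteriorRegion_completion_structure` (same hypotheses, same conclusions, verbatim) with ONE MORE printed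
conclusion, (ε) WALLS: *if `V` lies on one side of its minimal boundary `∂M = range B.f` (the
chart-straight curve through `B.f y` with velocity `B.ν y` stays outside `closure V` for small `t < 0`),
then the part of `∂M' = frontier U` off the pieces that are components of `K` inside `V` (the pieces
`P ⊆ V` admitting an open collar `O ⊆ V` with `O ∖ P ⊆ U`, doubly covered by `∂M'`) — i.e. the union of
the pieces of `∂K` bounding `K` on one side and of the components of `∂M` met by `U` — is a compact
smooth EMBEDDED minimal surface `f'` of `X` (possibly empty) with smooth unit normal `ν'`, each of whose
normal vectors `(f' z, ν' z)` is a sheet of `∂M'` (so `ν'` points into `U`), behind which lies no point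
of `M' = closure U` (the chart-straight curve through `f' z` with velocity `ν' z` stays outside
`closure U` for small `t < 0`: behind a bounding piece lies the interior of `K`, behind a boundary
component `X ∖ closure V`).* Typed in the currency of the declared fact's first disjunct (embedded
presentation) and of `CompletionBoundary.pointsInto` / `AFEnd.IsOutsideOf` (sidedness by chart-straight
normal curves; sheets compared in `TangentBundle (𝓡 3) X`). No area, energy or curvature content.
WHY IT MIGHT FAIL AS TYPED: as for `exteriorRegion_completion_structure` (the tree's packaging
`CompletionBoundary` / `IsOuterMinimizing`; the embedded / maximal-slice clause), plus the `O`-collar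
reading of "component of `K`" with `O ⊆ V` and the eventual chart-curve form of "bounds `K` on one
side". Requested by the decomp-fsc cell (lens-1 NODE-g20; replaces the unfiled refinement D34a′
(β)/(γ)/(δ) of NODE-g10 §4(a)); ledger item `wi-99777` (D34a″); consumer in that cell:
`WallEnclosure.outermostEnclosureBound_of_walls`.
[cite: HuiskenIlmanenIMCF2001, §4, Lemma 4.1 (i)–(ii) (pp. 389–390), its proof, and the remark following it] -/
def exteriorRegion_completion_structure_walls : Prop :=
  ∀ (X : Type) [TopologicalSpace X] [ChartedSpace E3 X] [IsManifold (𝓡 3) ∞ X] [T2Space X]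
    [SecondCountableTopology X] [ConnectedSpace X]
    (D : InitialDataSet (𝓡 3) X) [D.metric.HasLeviCivita] (e : AFEnd X) (V : Opens X)
    (B : MinimalBoundary D.h (V : Set X)),
    D.IsComplete → IsExteriorRegion e V → e.IsMetricAsymptoticallyFlat D 1 →
    ∃ (U : Opens X) (F : CompletionBoundary D.h (U : Set X)),
      U ≤ V ∧ IsExteriorRegion e U ∧ IsCompact (closure ((V : Set X) \ (U : Set X))) ∧
      (∀ y y' : F.surf, F.f '' connectedComponent y = F.f '' connectedComponent y' ∨
        Disjoint (F.f '' connectedComponent y) (F.f '' connectedComponent y')) ∧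
      (∀ y : F.surf, F.f '' connectedComponent y ⊆ (V : Set X) ∨
        F.f '' connectedComponent y ⊆ range B.f) ∧
      (∀ y : F.surf, F.f '' connectedComponent y ⊆ (V : Set X) →
        (∃ (S' : Type) (_ : TopologicalSpace S') (_ : ChartedSpace (EuclideanSpace ℝ (Fin 2)) S')
            (_ : IsManifold (𝓡 2) ∞ S') (_ : CompactSpace S') (_ : T2Space S') (_ : Nonempty S')
            (f' : S' → X) (ν' : NormalField (𝓡 3) f')
            (hpb' : contMDiff_pullbackBilin (𝓡 3) X (𝓡 2) S' ∞)
            (hf' : (ofRiemannian D.h).IsSpacelikeImmersion (𝓡 2) f'),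
            Manifold.IsSmoothEmbedding (𝓡 2) (𝓡 3) ∞ f' ∧
            (ofRiemannian D.h).IsUnitNormal (𝓡 2) f' ν' 1 ∧
            ContMDiff (𝓡 2) (𝓡 3).tangent ∞
              (fun z ↦ (TotalSpace.mk' E3 (f' z) (ν' z) : TangentBundle (𝓡 3) X)) ∧
            (ofRiemannian D.h).IsMaximalSlice f' hpb' hf' ν' ∧
            range f' = F.f '' connectedComponent y) ∨
        (∃ O : Set X, IsOpen O ∧ F.f '' connectedComponent y ⊆ O ∧ O ⊆ (V : Set X) ∧
            O \ F.f '' connectedComponent y ⊆ (U : Set X))) ∧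
      (Function.Injective F.f →
        ∀ N, IsMinimalSurfaceImage D.h N → N ⊆ closure (U : Set X) → N ⊆ range F.f) ∧
      F.IsOuterMinimizing D.h e ∧
      ((∀ y, ∀ᶠ t in 𝓝[<] (0 : ℝ), curveThrough (𝓡 3) (B.f y) (B.ν y) t ∉ closure (V : Set X)) →
        ∃ (S' : Type) (_ : TopologicalSpace S') (_ : ChartedSpace (EuclideanSpace ℝ (Fin 2)) S')
            (_ : IsManifold (𝓡 2) ∞ S') (_ : CompactSpace S') (_ : T2Space S')
            (f' : S' → X) (ν' : NormalField (𝓡 3) f')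
            (hpb' : contMDiff_pullbackBilin (𝓡 3) X (𝓡 2) S' ∞)
            (hf' : (ofRiemannian D.h).IsSpacelikeImmersion (𝓡 2) f'),
            Manifold.IsSmoothEmbedding (𝓡 2) (𝓡 3) ∞ f' ∧
            (ofRiemannian D.h).IsUnitNormal (𝓡 2) f' ν' 1 ∧
            ContMDiff (𝓡 2) (𝓡 3).tangent ∞
              (fun z ↦ (TotalSpace.mk' E3 (f' z) (ν' z) : TangentBundle (𝓡 3) X)) ∧
            (ofRiemannian D.h).IsMaximalSlice f' hpb' hf' ν' ∧
            range f' = (range F.f \ ⋃ (y : F.surf) (_ : ∃ O : Set X, IsOpen O ∧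
                F.f '' connectedComponent y ⊆ O ∧ O ⊆ (V : Set X) ∧
                O \ F.f '' connectedComponent y ⊆ (U : Set X)), F.f '' connectedComponent y) ∧
            (∀ z, ∃ y : F.surf, (TotalSpace.mk' E3 (F.f y) (F.ν y) : TangentBundle (𝓡 3) X) =
                TotalSpace.mk' E3 (f' z) (ν' z)) ∧
            (∀ z, ∀ᶠ t in 𝓝[<] (0 : ℝ), curveThrough (𝓡 3) (f' z) (ν' z) t ∉ closure (U : Set X)))

/-- The walls form implies the declared form `exteriorRegion_completion_structure` (drop clause (ε));
both render the same printed lemma.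
[cite: HuiskenIlmanenIMCF2001, §4, Lemma 4.1 (i)–(ii) (pp. 389–390)] -/
theorem exteriorRegion_completion_structure_walls.to_structure
    (hW : exteriorRegion_completion_structure_walls) : exteriorRegion_completion_structure :=
  fun X _ _ _ _ _ _ D _ e V B hc hV hAF ↦ by
    obtain ⟨U, F, h1, h2, h3, h4, h5, h6, h7, h8, -⟩ := hW X D e V B hc hV hAF
    exact ⟨U, F, h1, h2, h3, h4, h5, h6, h7, h8⟩

/-! ### Bray's Theorem 19 for exterior-region completions (named fact) -/

/-- **Riemannian Penrose inequality for exterior regions, boundary area with multiplicity, and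
the bookkeeping of its case of equality** (named fact; Bray, J. Differential Geom. 59 (2001),
Thm. 19 (p. 240), as printed: *"Let `(M³, g)` be a complete, smooth, asymptotically flat
`3`-manifold with boundary which has nonnegative scalar curvature and total mass `m`. Then if
the boundary is an outer-minimizing horizon (with one or more components) of total area `A`,
then `m ≥ √(A/16π)` with equality if and only if `(M³, g)` is isometric to a Schwarzschild
manifold outside their respective outermost horizons"* — asymptotic flatness as in §13,
Def. 21, `m` the flux limit (225), "horizon" and "outer-minimizing" as in §2, Defs. 4 and 6;
§13, before Thm. 19: *"none of the arguments in this paper have used anything about the original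
manifold inside the original horizon"*). Vendored — the text recorded in the module docstring
("The two statements") with the printed whole-boundary inequality added as first conclusion —
for `M = M'` the metric completion of an open connected region `U` of the complete boundaryless
data manifold `(X, h)` (`D.IsComplete`) with exactly one end, the end `e` (`IsExteriorRegion e U`;
Def. 21 allows several ends `{E_k}` — this is the single-end case), whose boundary `∂M'` is a
compact minimal surface given with its sheets over `frontier U` (`F : CompletionBoundary D.h U`,
Huisken–Ilmanen's metric-completion boundary, §4, Lemma 4.1 and the remark following it) and is
outer-minimizing (`F.IsOuterMinimizing D.h e`), so that `A = |∂M'| = totalArea (F.f^* h)` is the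
area of `frontier U` counted with multiplicity; the special case `p = 1` of Def. 21 (which asks
only `p > (n − 2)/2 = 1/2`) for the single end `e`, as `IsMetricAsymptoticallyFlat e D 1`, together
with `|R(h)| = O(r^{-q})` for some `q > 3` (`scalarCurvatureCoeff`; Def. 21's `q > n`), the ADM
energy flux limit existing (`m = e.admEnergy D`, normalisation of (225)); `R(h) ≥ 0` on
`closure U`. Conclusions: FIRST, the printed inequality `√(A/16π) ≤ m` for the whole boundary
with multiplicity; THEN, for a *nonempty* compact surface `Σ₀` smoothly embedded into `X` by `f₀`
with `range f₀ ⊆ range F.f = frontier U` (an open and closed union of pieces of `∂M'`, of area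
`|Σ₀| = totalArea (f₀^* h) ≤ A` by Federer 1969, §3.2.46 — these two clauses are COROLLARIES of
Thm. 19 via that area comparison, recorded in the form the consumers use, not the printed
statement itself): (a) `√(|Σ₀|/16π) ≤ m`; (b) if `√(|Σ₀|/16π) = m`, then `A = |Σ₀|`, so the
sheets of `∂M'` off `F.f ⁻¹' (range f₀)` are absent (`range F.f ⊆ range f₀`) and `Σ₀` is covered
once (`F.f` injective). The remaining content of the case of equality (Schwarzschild outside the
outermost horizon) is NOT part of this fact: it is `Bray2001_penrose_rigidity_exteriorRegion`
(`PenroseRigidity.lean`). WHY IT MIGHT FAIL AS TYPED: Thm. 19 is printed for a smooth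
asymptotically flat manifold *with boundary* whose boundary is an outer-minimizing horizon;
reading `M` as the metric completion `M'` of `U` with `∂M'` presented by sheets-with-multiplicity
over `frontier U` is the tree's vendoring (supported by Huisken–Ilmanen's remark after Lemma 4.1,
whose Main Theorem counts `|∂M'|` the same way) — should `CompletionBoundary`/`totalArea` count
multiplicity differently from Bray's `A`, or should Def. 21 ∕ (225) not be exactly
`IsMetricAsymptoticallyFlat e D 1` + the `scalarCurvatureCoeff` decay + `HasADMEnergy`, the
declared `Prop` could overstate the theorem; clause (b) is only the area bookkeeping
`16π m² = |Σ₀| ≤ A ≤ 16π m²`. Ledger item `wi-98471` (D34b, lens-1 NODE-g9 §4(a)).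
[cite: BrayRPI2001, Thm. 19 (p. 240) with §2 Defs. 4, 6, §13 Def. 21 and (225)]
[cite: HuiskenIlmanenIMCF2001, §4, Lemma 4.1 and the remark following it] -/
def Bray2001_penrose_completionBoundary : Prop :=
  ∀ (X : Type) [TopologicalSpace X] [ChartedSpace E3 X] [IsManifold (𝓡 3) ∞ X] [T2Space X]
    [SecondCountableTopology X] [ConnectedSpace X]
    (D : InitialDataSet (𝓡 3) X) [D.metric.HasLeviCivita] (e : AFEnd X) (U : Opens X)
    (F : CompletionBoundary D.h (U : Set X)),
    D.IsComplete → IsExteriorRegion e U → e.IsMetricAsymptoticallyFlat D 1 →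
    (∃ q : ℝ, 3 < q ∧
      (fun x ↦ e.scalarCurvatureCoeff D x) =O[Bornology.cobounded E3] fun x ↦ ‖x‖ ^ (-q)) →
    (∃ m, e.HasADMEnergy D m) →
    (∀ x ∈ closure (U : Set X), 0 ≤ D.metric.scalarCurvature x) →
    F.IsOuterMinimizing D.h e →
    Real.sqrt ((totalArea ((ofRiemannian D.h).inducedRiemannianMetric F.f F.hpb
        F.isSpacelikeImmersion)).toReal / (16 * π)) ≤ e.admEnergy D ∧
    ∀ (S₀ : Type) [TopologicalSpace S₀] [ChartedSpace (EuclideanSpace ℝ (Fin 2)) S₀]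
      [IsManifold (𝓡 2) ∞ S₀] [CompactSpace S₀] [T2Space S₀]
      [MeasurableSpace S₀] [BorelSpace S₀]
      (f₀ : S₀ → X) (hpb₀ : contMDiff_pullbackBilin (𝓡 3) X (𝓡 2) S₀ ∞)
      (hf₀ : (ofRiemannian D.h).IsSpacelikeImmersion (𝓡 2) f₀),
      Manifold.IsSmoothEmbedding (𝓡 2) (𝓡 3) ∞ f₀ → range f₀ ⊆ range F.f → Nonempty S₀ →
      Real.sqrt ((totalArea ((ofRiemannian D.h).inducedRiemannianMetric f₀ hpb₀ hf₀)).toReal /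
          (16 * π)) ≤ e.admEnergy D ∧
      (Real.sqrt ((totalArea ((ofRiemannian D.h).inducedRiemannianMetric f₀ hpb₀ hf₀)).toReal /
          (16 * π)) = e.admEnergy D →
        range F.f ⊆ range f₀ ∧ Function.Injective F.f)

/-- The printed inequality of `Bray2001_penrose_completionBoundary` by itself, for a user holding
the fact as a hypothesis: `√(A/16π) ≤ m` with `A = |∂M'|` counted with multiplicity.
[cite: BrayRPI2001, Thm. 19 (p. 240)] -/
theorem Bray2001_penrose_completionBoundary.sqrt_totalArea_le_admEnergy
    (hB : Bray2001_penrose_completionBoundary)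
    (X : Type) [TopologicalSpace X] [ChartedSpace E3 X] [IsManifold (𝓡 3) ∞ X] [T2Space X]
    [SecondCountableTopology X] [ConnectedSpace X]
    (D : InitialDataSet (𝓡 3) X) [D.metric.HasLeviCivita] (e : AFEnd X) (U : Opens X)
    (F : CompletionBoundary D.h (U : Set X))
    (hc : D.IsComplete) (hU : IsExteriorRegion e U) (hAF : e.IsMetricAsymptoticallyFlat D 1)
    (hR : ∃ q : ℝ, 3 < q ∧
      (fun x ↦ e.scalarCurvatureCoeff D x) =O[Bornology.cobounded E3] fun x ↦ ‖x‖ ^ (-q))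
    (hm : ∃ m, e.HasADMEnergy D m)
    (hpos : ∀ x ∈ closure (U : Set X), 0 ≤ D.metric.scalarCurvature x)
    (hout : F.IsOuterMinimizing D.h e) :
    Real.sqrt ((totalArea ((ofRiemannian D.h).inducedRiemannianMetric F.f F.hpb
        F.isSpacelikeImmersion)).toReal / (16 * π)) ≤ e.admEnergy D :=
  (hB X D e U F hc hU hAF hR hm hpos hout).1

/-- Clause (a) of `Bray2001_penrose_completionBoundary` by itself: `√(|Σ₀|/16π) ≤ m` for every
nonempty compact surface `Σ₀` smoothly embedded onto a union of pieces of the outer-minimizing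
completion boundary (a corollary of Thm. 19 via Federer §3.2.46, `|Σ₀| ≤ A`).
[cite: BrayRPI2001, Thm. 19 (p. 240)] -/
theorem Bray2001_penrose_completionBoundary.sqrt_area_le_admEnergy
    (hB : Bray2001_penrose_completionBoundary)
    (X : Type) [TopologicalSpace X] [ChartedSpace E3 X] [IsManifold (𝓡 3) ∞ X] [T2Space X]
    [SecondCountableTopology X] [ConnectedSpace X]
    (D : InitialDataSet (𝓡 3) X) [D.metric.HasLeviCivita] (e : AFEnd X) (U : Opens X)
    (F : CompletionBoundary D.h (U : Set X))
    (hc : D.IsComplete) (hU : IsExteriorRegion e U) (hAF : e.IsMetricAsymptoticallyFlat D 1)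
    (hR : ∃ q : ℝ, 3 < q ∧
      (fun x ↦ e.scalarCurvatureCoeff D x) =O[Bornology.cobounded E3] fun x ↦ ‖x‖ ^ (-q))
    (hm : ∃ m, e.HasADMEnergy D m)
    (hpos : ∀ x ∈ closure (U : Set X), 0 ≤ D.metric.scalarCurvature x)
    (hout : F.IsOuterMinimizing D.h e)
    (S₀ : Type) [TopologicalSpace S₀] [ChartedSpace (EuclideanSpace ℝ (Fin 2)) S₀]
    [IsManifold (𝓡 2) ∞ S₀] [CompactSpace S₀] [T2Space S₀] [MeasurableSpace S₀] [BorelSpace S₀]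
    (f₀ : S₀ → X) (hpb₀ : contMDiff_pullbackBilin (𝓡 3) X (𝓡 2) S₀ ∞)
    (hf₀ : (ofRiemannian D.h).IsSpacelikeImmersion (𝓡 2) f₀)
    (hemb : Manifold.IsSmoothEmbedding (𝓡 2) (𝓡 3) ∞ f₀) (hsub : range f₀ ⊆ range F.f)
    (hne : Nonempty S₀) :
    Real.sqrt ((totalArea ((ofRiemannian D.h).inducedRiemannianMetric f₀ hpb₀ hf₀)).toReal /
        (16 * π)) ≤ e.admEnergy D :=
  ((hB X D e U F hc hU hAF hR hm hpos hout).2 S₀ f₀ hpb₀ hf₀ hemb hsub hne).1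

/-- Clause (b) of `Bray2001_penrose_completionBoundary` by itself: in the case of equality
`√(|Σ₀|/16π) = m` the completion boundary has no sheet off `Σ₀` and is singly covered.
[cite: BrayRPI2001, Thm. 19 (p. 240)] -/
theorem Bray2001_penrose_completionBoundary.injective_of_eq
    (hB : Bray2001_penrose_completionBoundary)
    (X : Type) [TopologicalSpace X] [ChartedSpace E3 X] [IsManifold (𝓡 3) ∞ X] [T2Space X]
    [SecondCountableTopology X] [ConnectedSpace X]
    (D : InitialDataSet (𝓡 3) X) [D.metric.HasLeviCivita] (e : AFEnd X) (U : Opens X)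
    (F : CompletionBoundary D.h (U : Set X))
    (hc : D.IsComplete) (hU : IsExteriorRegion e U) (hAF : e.IsMetricAsymptoticallyFlat D 1)
    (hR : ∃ q : ℝ, 3 < q ∧
      (fun x ↦ e.scalarCurvatureCoeff D x) =O[Bornology.cobounded E3] fun x ↦ ‖x‖ ^ (-q))
    (hm : ∃ m, e.HasADMEnergy D m)
    (hpos : ∀ x ∈ closure (U : Set X), 0 ≤ D.metric.scalarCurvature x)
    (hout : F.IsOuterMinimizing D.h e)
    (S₀ : Type) [TopologicalSpace S₀] [ChartedSpace (EuclideanSpace ℝ (Fin 2)) S₀]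
    [IsManifold (𝓡 2) ∞ S₀] [CompactSpace S₀] [T2Space S₀] [MeasurableSpace S₀] [BorelSpace S₀]
    (f₀ : S₀ → X) (hpb₀ : contMDiff_pullbackBilin (𝓡 3) X (𝓡 2) S₀ ∞)
    (hf₀ : (ofRiemannian D.h).IsSpacelikeImmersion (𝓡 2) f₀)
    (hemb : Manifold.IsSmoothEmbedding (𝓡 2) (𝓡 3) ∞ f₀) (hsub : range f₀ ⊆ range F.f)
    (hne : Nonempty S₀)
    (heq : Real.sqrt ((totalArea ((ofRiemannian D.h).inducedRiemannianMetric f₀ hpb₀ hf₀)).toReal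
        / (16 * π)) = e.admEnergy D) :
    range F.f ⊆ range f₀ ∧ Function.Injective F.f :=
  ((hB X D e U F hc hU hAF hR hm hpos hout).2 S₀ f₀ hpb₀ hf₀ hemb hsub hne).2 heq

end Literature.Geometry.Lorentzian

end
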